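import Mathlib
import HarnessLib
import Summits.Langlands.Statement
import Summits.Langlands.Langlands.Theses.DepthPrimeSplit
import Summits.Langlands.Langlands.Theses.AuxiliaryLevelSplit
import Summits.Langlands.Langlands.Theses.PrimeSwitchSplit
import Summits.Langlands.Langlands.Theorems.TransientLevelSplitLevelFiniteness
import Summits.Langlands.Langlands.Theorems.IwahoriTransientGalois
import Summits.Langlands.Langlands.Theorems.IwahoriTransientRoots
import Literature.NumberTheory.GaloisRepresentations.ResidualPairIntegrality
import Summits.Langlands.Langlands.Theorems.WeakFernSplitFernSpread
import Summits.Langlands.Langlands.Theorems.FernRankSplitExchange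

/-!
# FernRankSplit (census twin part 2/2; part 1/2 = `FernRankSplitExchange`) — lens-3 gen 30 node of the cell `decomp-langlands` (planner-decomp-langlands-lens-3-g30-0, 2026-08-31)

TARGET (by name): FERN = `Theses.DepthPrimeSplit.FernSpread` (stmt-Langlands-25024, rank-3 crux of route-Langlands-DepthPrimeSplit), its DPS sibling CLASS =
`DepthPrimeSplit.Classicality` (25026), and the root `_root_.Langlands` through `DepthPrimeSplit.closes`.  LINEAGE: gen 29 `WeakFernSplit` (PART A = its census twin LANDED in the tree as
`Theorems/WeakFernSplitFernSpread.lean` 19:25Z, imported BY NAME — it renamed W2S to `WeakToStrongFern`; node CLEARED crit-1 g11 19:14Z; v1 of this node inlined it): FERN ⟺ HF ∧ W2S where HF «Hecke fern: H1 ⟹ C_w (weakly pro-automorphic: every 𝒪-relation of a FINITE cuspidal family holds at ρ to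
depth r)» and the declared residual W2S «weak ⟹ strong: H1 ∧ C_w ⟹ C», tagged IDEA-NEEDED with no typed content behind the tag.
THIS NODE puts a THEOREM under the residual.  KERNEL (§13, `exchange` / `exchange_explicit`, sorry-free): the SIZE–DEPTH EXCHANGE — if a family of k cusp forms
weakly r-approximates ρ off S (ρ unramified off S), then ONE member is strongly r^{1/k}-close to ρ at EVERY place off S.  (Proof: were every member s-far from ρ
somewhere, pick per member a bad place/Frobenius/coefficient (v_j, σ_j, i_j) and a uniform Frobenius choice; the 𝒪-relation ∏_j (b_j·X_{(v_j,i_j)} − b_j·a_j), with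
a_j the member's Satake coefficient and b_j = 1 or a_j⁻¹ (whichever is integral), vanishes at the family and has valuation ≥ s^k at ρ's point: contradiction with
r ≤ s^k.  Exponent 1/k SHARP: `toy_exchange_sharp`, 𝒪 = ℤ, family {0, 2ℓ}, point ℓ.)
THE ONE TRANSLATION (lens-3's single EQUIV, §13 `pro_iff_boundedWeak`, for a.e.-unramified ρ — automatic in the frame, `IsPinnedGeometric`):
        C «pro-automorphic of bounded level»  ⟺  C_b «BOUNDEDLY weakly pro-automorphic»: ONE finite S and ONE size k such that for every depth r some k-member
        cuspidal family weakly r-approximates ρ off S  (`IsBoundedlyWeaklyProAutomorphic`; ⟸ is the exchange at radius min(r,1), ⟹ is size one).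
Hence the lineage residual is RE-TYPED EXACTLY (§14 `rankBound_iff_weakToStrong`, modulo NOTHING):   W2S ⟺ RANK `FernRankBound` : H1 ∧ C_w ⟹ C_b
«the sizes of the weakly approximating families can be kept BOUNDED as the depth → ∞» = «ρ is an 𝒪-point of cuspidal Hecke algebras 𝕋(π_1 ⊕ … ⊕ π_k) of BOUNDED
RANK to every depth».  «Weak ⟹ strong eigenform lifting at free weight» (Chen–Kiming–Wiese arXiv:1105.1918 §5, open even for GL₂/ℚ as a lifting problem) is thereby
identified with a FINITENESS statement whose engine is in print: an eigenvariety through the weak point, LOCALLY FINITE AND FLAT OF BOUNDED DEGREE over weight space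
(Coleman–Mazur, Buzzard «eigenvarieties» §5, Chenevier, Andreatta–Iovita–Pilloni for Hilbert), supplies classical points of bounded number over weights κ_i → κ(ρ)
whose eigensystems converge to ρ's — a bounded-size family to every depth — and the exchange converts bounded size into depth.  TAGS of RANK: OPEN · WEAKER than
FERN (`rankBound_of_fernSpread`) and than g29's WCL (`rankBound_of_weakClassicality`) · root-implied (`rankBound_of_langlands`, no EXCESS) · ATTACKABLE-mod-PRINT on
the finite-slope l₀ = 0 sector INCLUDING IRREGULAR weight (overconvergence of trianguline promodular points: Emerton Thm 1.2.4(1); Kisin; the bounded degree needs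
no classicality AT ρ, only NEAR ρ at classical weights: Coleman's small-slope theorem) · IDEA-NEEDED at infinite slope (no family) · BARRIER l₀ > 0 (eigenvarieties
not flat over weight space: Calegari–Mazur, Gee–Newton; TaylorWilesNumericalCoincidence) · NonRegularWeightBarrier DISCHARGED for finite slope (the point of the cut).
SPLIT BENEATH (all modulo NOTHING):  FERN ⟺ HF ∧ RANK (`fernSpread_iff_heckeFern_and_rankBound`);  WCL ⟺ RANK ∧ CLASS
(`weakClassicality_iff_rankBound_and_classicality` — g29's bypass piece was the residual AND CLASS glued, not a third thing);  FERN ∧ CLASS ⟺ HF ∧ RANK ∧ CLASS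
(`fernClass_iff_three`); root frame `closes_root` (DPS's nine binders with FERN ↦ HF, RANK); child-route glue `closes_route : HF → RANK → EXCH → FERN` with the glue
item EXCH `SizeDepthExchange` (C_b ⟹ C in the frame) PROVED (`sizeDepthExchange_holds`).
THE LADDER IN ONE CURRENCY (§13 `ladder_dictionary`, three certified iffs for a.e.-unramified ρ; currency = finite cuspidal families + 𝒪-relations; dials = depth,
SIZE, FREEZING):  H1 ⟺ wH1 (depth 1, any size: `residual_iff_weaklyResidual`) · C ⟺ C_b (every depth, bounded size) · weakly automorphic ⟺ C_f «ONE frozen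
family to every depth» (`weakly_iff_frozen`: exchange at radii 2^{-m} + pigeonhole + Archimedes).  So the DPS pair reads FERN ∧ CLASS ⟺ HF ∧ RANK ∧ FREEZE
(`fernClass_iff_currency`): GROWTH (families exist to every depth) · RANK (sizes stay bounded) · RIGIDITY (one family can be frozen) — CLASS ⟺ FREEZE exactly
(`classicality_iff_freeze`).
NEGATIVE STRUCTURAL FINDING (memo §4): the size dial is TWO-VALUED modulo the exchange — every bounded (indeed every eventually-constant) size profile is already C,
and the minimal weak-not-strong growth is attained by NON-geometric toy points — so NO intermediate growth-rate piece sits strictly between C_w and C: W2S does not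
split further by size; its content is RANK, whose interior is eigenvariety geometry (finite slope) and genuinely dark at infinite slope / l₀ > 0.
WHY NOVEL (vs g20–g29 and the tree): every earlier cut of this lineage typed the residual as a LIFTING problem (level shape g25–g28, weak ⟹ strong g29); none has a
theorem relating weak and strong approximation.  The exchange is that theorem; it is interface-free (MvPolynomial over the valuation ring, no ρ_π, no eigenvariety
posited), and it re-files the residual under Hida/Coleman FINITENESS, for which NonRegularWeightBarrier does not bite.  Nearest tree item: 18474
`CMFreeCompletedClosure.ProAutomorphy` (completed-cohomology interface; not comparable).  0 sorry; axioms propext / Classical.choice / Quot.sound (checked on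
`closes_root`, `ladder_dictionary`, `fernClass_iff_currency`, `sizeDepthExchange_holds`).  Record: HOME/lens-3/g30/frs/memo.md; kit RUNME.md.
-/

set_option linter.dupNamespace false
set_option linter.unusedVariables false

namespace Summit.Langlands.Langlands.Theorems.FernRank

open scoped NumberField Polynomial
open Filter Field IsDedekindDomain
open Literature.NumberTheory.GaloisRepresentations Literature.NumberTheory.Automorphic
open Summit.Langlands.Langlands.Theorems.TransientLevel Summit.Langlands.Langlands.Theorems.WeakFern
open Summit.Langlands.Langlands.Theses

/-! ## 12. The new item (one-line text = statements30.json VERBATIM, generated by gen30.py from the g29 macros) -/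

/-- RANK · FINITE-RANK FERN BRANCH · the re-typed residual of the lineage · EXACT twin of W2S (`rankBound_iff_weakToStrong`, modulo NOTHING)
· WEAKER than FERN (`rankBound_of_fernSpread`) and than WCL (`rankBound_of_weakClassicality`) · OPEN · ATTACKABLE-mod-PRINT on the
finite-slope l₀ = 0 sector INCLUDING irregular weight (Emerton Thm 1.2.4(1): trianguline promodular ⟹ overconvergent finite slope;
Coleman–Mazur/Buzzard: the eigenvariety is locally finite flat over weight space; Coleman: small slope ⟹ classical — a bounded-degree
family of CLASSICAL points over weights k_i → κ(ρ) weakly approximates ρ to depth → ∞, and the EXCHANGE turns bounded degree into depth)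
· IDEA-NEEDED at infinite slope · BARRIER l₀ > 0 (eigenvarieties not flat over weight space).  W2S's binders and hypotheses VERBATIM;
conclusion C_b instead of C. -/
def FernRankBound : Prop :=
  ∀ (K : Type) [Field K] [NumberField K] (n : ℕ) (hcpt : Literature.NumberTheory.Automorphic.isCompact_glFiniteIntegralLevel n K), 0 < n → ∀ (ℓ : ℕ) [Fact ℓ.Prime] (ι : PadicAlgCl ℓ ≃+* ℂ) (ρ : Literature.NumberTheory.GaloisRepresentations.FramedGaloisRep K (PadicAlgCl ℓ) n), ρ.toGaloisRep.IsIrreducible → ((∀ᶠ v : IsDedekindDomain.HeightOneSpectrum (NumberField.RingOfIntegers K) in Filter.cofinite, ρ.IsUnramifiedAt v) ∧ ∀ (v : IsDedekindDomain.HeightOneSpectrum (NumberField.RingOfIntegers K)) (hv : ((ℓ : ℕ) : NumberField.RingOfIntegers K) ∈ v.asIdeal), (Literature.NumberTheory.PAdicHodge.fontainePstAdicCompletion v ℓ hv).IsDeRhamFramed (ρ.toLocal v)) → (∃ π : Literature.NumberTheory.Automorphic.CuspidalAutomorphicRepData n K hcpt, π.1.IsLAlgebraic ∧ ∀ᶠ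 v : IsDedekindDomain.HeightOneSpectrum (NumberField.RingOfIntegers K) in Filter.cofinite, (∃ α : Multiset ℂ, π.1.HasSatakeParamAt v α ∧ ∀ 𝔓 ∈ v.primesAbove, ∀ σ : Field.absoluteGaloisGroup K, IsArithFrobAt (NumberField.RingOfIntegers K) σ 𝔓 → ∀ i : ℕ, Valued.v ((Literature.NumberTheory.GaloisRepresentations.FramedRep.charpoly ρ σ - Literature.NumberTheory.Automorphic.arithFrobPolyOfSatake ι v.residueCard 1 α).coeff i) < 1)) → (∃ S : Set (IsDedekindDomain.HeightOneSpectrum (NumberField.RingOfIntegers K)), S.Finite ∧ ∀ r : NNReal, 0 < r → ∃ (k : ℕ) (π : Fin k → Literature.NumberTheory.Automorphic.CuspidalAutomorphicRepData n K hcpt) (α : Fin k → IsDedekindDomain.HeightOneSpectrum (NumberField.RingOfIntegers K) → Multiset ℂ), (∀ j : Fin k, (π j).1.IsLAlgebraic ∧ ∀ v : IsDedekindDomain.HeightOneSpectrum (NumberField.RingOfIntegers K), v ∉ S → (π j).1.HasSatakeParamAt v (α j v)) ∧ ∀ Φ : IsDedekindDomain.HeightOneSpectrum (NumberField.RingOfIntegers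 K) → Field.absoluteGaloisGroup K, (∀ v : IsDedekindDomain.HeightOneSpectrum (NumberField.RingOfIntegers K), v ∉ S → ∃ 𝔓 ∈ v.primesAbove, IsArithFrobAt (NumberField.RingOfIntegers K) (Φ v) 𝔓) → ∀ P : MvPolynomial ({v : IsDedekindDomain.HeightOneSpectrum (NumberField.RingOfIntegers K) // v ∉ S} × ℕ) (Valued.v : Valuation (PadicAlgCl ℓ) NNReal).valuationSubring, (∀ j : Fin k, MvPolynomial.eval₂ (Valued.v : Valuation (PadicAlgCl ℓ) NNReal).valuationSubring.subtype (fun x : {v : IsDedekindDomain.HeightOneSpectrum (NumberField.RingOfIntegers K) // v ∉ S} × ℕ => (Literature.NumberTheory.Automorphic.arithFrobPolyOfSatake ι x.1.1.residueCard 1 (α j x.1.1)).coeff x.2) P = 0) → Valued.v (MvPolynomial.eval₂ (Valued.v : Valuation (PadicAlgCl ℓ) NNReal).valuationSubring.subtype (fun x : {v : IsDedekindDomain.HeightOneSpectrum (NumberField.RingOfIntegers K) // v ∉ S} × ℕ => (Literature.NumberTheory.GaloisRepresentations.FramedRep.charpoly ρ (Φ x.1.1)).coeff x.2) P) < r) →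 ∃ S : Set (IsDedekindDomain.HeightOneSpectrum (NumberField.RingOfIntegers K)), S.Finite ∧ ∃ k : ℕ, ∀ r : NNReal, 0 < r → ∃ (π : Fin k → Literature.NumberTheory.Automorphic.CuspidalAutomorphicRepData n K hcpt) (α : Fin k → IsDedekindDomain.HeightOneSpectrum (NumberField.RingOfIntegers K) → Multiset ℂ), (∀ j : Fin k, (π j).1.IsLAlgebraic ∧ ∀ v : IsDedekindDomain.HeightOneSpectrum (NumberField.RingOfIntegers K), v ∉ S → (π j).1.HasSatakeParamAt v (α j v)) ∧ ∀ Φ : IsDedekindDomain.HeightOneSpectrum (NumberField.RingOfIntegers K) → Field.absoluteGaloisGroup K, (∀ v : IsDedekindDomain.HeightOneSpectrum (NumberField.RingOfIntegers K), v ∉ S → ∃ 𝔓 ∈ v.primesAbove, IsArithFrobAt (NumberField.RingOfIntegers K) (Φ v) 𝔓) → ∀ P : MvPolynomial ({v : IsDedekindDomain.HeightOneSpectrum (NumberField.RingOfIntegers K) // v ∉ S} × ℕ) (Valued.v : Valuation (PadicAlgCl ℓ) NNReal).valuationSubring, (∀ j : Fin k, MvPolynomial.eval₂ (Valued.v : Valuation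 (PadicAlgCl ℓ) NNReal).valuationSubring.subtype (fun x : {v : IsDedekindDomain.HeightOneSpectrum (NumberField.RingOfIntegers K) // v ∉ S} × ℕ => (Literature.NumberTheory.Automorphic.arithFrobPolyOfSatake ι x.1.1.residueCard 1 (α j x.1.1)).coeff x.2) P = 0) → Valued.v (MvPolynomial.eval₂ (Valued.v : Valuation (PadicAlgCl ℓ) NNReal).valuationSubring.subtype (fun x : {v : IsDedekindDomain.HeightOneSpectrum (NumberField.RingOfIntegers K) // v ∉ S} × ℕ => (Literature.NumberTheory.GaloisRepresentations.FramedRep.charpoly ρ (Φ x.1.1)).coeff x.2) P) < r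

/-- RANK read in the frame: H1 ⟹ C_w ⟹ C_b. -/
theorem rankBound_iff : FernRankBound ↔ Frame fun hcpt ι ρ =>
    IsResiduallyAutomorphic hcpt ι ρ → IsWeaklyProAutomorphic hcpt ι ρ → IsBoundedlyWeaklyProAutomorphic hcpt ι ρ := Iff.rfl

/-- EXCH · the GLUE item of the child route (kind support; PROVED below, `sizeDepthExchange_holds`): in the frame, C_b ⟹ C — bounded-size weak
approximation to every depth IS eigenform approximation to every depth (the size–depth exchange).  One-line text = statements30.json VERBATIM. -/
def SizeDepthExchange : Prop :=
  ∀ (K : Type) [Field K] [NumberField K] (n : ℕ) (hcpt : Literature.NumberTheory.Automorphic.isCompact_glFiniteIntegralLevel n K), 0 < n → ∀ (ℓ : ℕ) [Fact ℓ.Prime] (ι : PadicAlgCl ℓ ≃+* ℂ) (ρ : Literature.NumberTheory.GaloisRepresentations.FramedGaloisRep K (PadicAlgCl ℓ) n), ρ.toGaloisRep.IsIrreducible → ((∀ᶠ v : IsDedekindDomain.HeightOneSpectrum (NumberField.RingOfIntegers K) in Filter.cofinite, ρ.IsUnramifiedAt v) ∧ ∀ (v : IsDedekindDomain.HeightOneSpectrum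 (NumberField.RingOfIntegers K)) (hv : ((ℓ : ℕ) : NumberField.RingOfIntegers K) ∈ v.asIdeal), (Literature.NumberTheory.PAdicHodge.fontainePstAdicCompletion v ℓ hv).IsDeRhamFramed (ρ.toLocal v)) → (∃ S : Set (IsDedekindDomain.HeightOneSpectrum (NumberField.RingOfIntegers K)), S.Finite ∧ ∃ k : ℕ, ∀ r : NNReal, 0 < r → ∃ (π : Fin k → Literature.NumberTheory.Automorphic.CuspidalAutomorphicRepData n K hcpt) (α : Fin k → IsDedekindDomain.HeightOneSpectrum (NumberField.RingOfIntegers K) → Multiset ℂ), (∀ j : Fin k, (π j).1.IsLAlgebraic ∧ ∀ v : IsDedekindDomain.HeightOneSpectrum (NumberField.RingOfIntegers K), v ∉ S → (π j).1.HasSatakeParamAt v (α j v)) ∧ ∀ Φ : IsDedekindDomain.HeightOneSpectrum (NumberField.RingOfIntegers K) → Field.absoluteGaloisGroup K, (∀ v : IsDedekindDomain.HeightOneSpectrum (NumberField.RingOfIntegers K), v ∉ S → ∃ 𝔓 ∈ v.primesAbove, IsArithFrobAt (NumberField.RingOfIntegers K) (Φ v) 𝔓) → ∀ P : MvPolynomial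 ({v : IsDedekindDomain.HeightOneSpectrum (NumberField.RingOfIntegers K) // v ∉ S} × ℕ) (Valued.v : Valuation (PadicAlgCl ℓ) NNReal).valuationSubring, (∀ j : Fin k, MvPolynomial.eval₂ (Valued.v : Valuation (PadicAlgCl ℓ) NNReal).valuationSubring.subtype (fun x : {v : IsDedekindDomain.HeightOneSpectrum (NumberField.RingOfIntegers K) // v ∉ S} × ℕ => (Literature.NumberTheory.Automorphic.arithFrobPolyOfSatake ι x.1.1.residueCard 1 (α j x.1.1)).coeff x.2) P = 0) → Valued.v (MvPolynomial.eval₂ (Valued.v : Valuation (PadicAlgCl ℓ) NNReal).valuationSubring.subtype (fun x : {v : IsDedekindDomain.HeightOneSpectrum (NumberField.RingOfIntegers K) // v ∉ S} × ℕ => (Literature.NumberTheory.GaloisRepresentations.FramedRep.charpoly ρ (Φ x.1.1)).coeff x.2) P) < r) → ∃ S : Set (IsDedekindDomain.HeightOneSpectrum (NumberField.RingOfIntegers K)), S.Finite ∧ ∀ r : NNReal, 0 < r → ∃ π : Literature.NumberTheory.Automorphic.CuspidalAutomorphicRepData n K hcpt, π.1.IsLAlgebraic ∧ ∀ v : IsDedekindDomain.HeightOneSpectrum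 (NumberField.RingOfIntegers K), v ∉ S → (∃ α : Multiset ℂ, π.1.HasSatakeParamAt v α ∧ ∀ 𝔓 ∈ v.primesAbove, ∀ σ : Field.absoluteGaloisGroup K, IsArithFrobAt (NumberField.RingOfIntegers K) σ 𝔓 → ∀ i : ℕ, Valued.v ((Literature.NumberTheory.GaloisRepresentations.FramedRep.charpoly ρ σ - Literature.NumberTheory.Automorphic.arithFrobPolyOfSatake ι v.residueCard 1 α).coeff i) < r)

/-- EXCH read in the frame: C_b ⟹ C. -/
theorem sizeDepthExchange_iff : SizeDepthExchange ↔ Frame fun hcpt ι ρ =>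
    IsBoundedlyWeaklyProAutomorphic hcpt ι ρ → IsProAutomorphic hcpt ι ρ := Iff.rfl

/-! ## 14. The split beneath the EQUIV: RANK ⟺ W2S; FERN ⟺ HF ∧ RANK; WCL ⟺ RANK ∧ CLASS; CLASS ⟺ FREEZE (all modulo NOTHING) -/

/-- RANK ⟹ W2S: the exchange (`pro_of_boundedWeak`; the frame's `IsPinnedGeometric` supplies a.e.-unramifiedness). -/
theorem weakToStrong_of_rankBound (h : FernRankBound) : WeakToStrongFern :=
  fun K _ _ n hcpt hn ℓ _ ι ρ hirr hgeo h1 hw => pro_of_boundedWeak hgeo.1 (h K n hcpt hn ℓ ι ρ hirr hgeo h1 hw)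

/-- W2S ⟹ RANK: size one (`boundedWeak_of_pro`). -/
theorem rankBound_of_weakToStrong (h : WeakToStrongFern) : FernRankBound :=
  fun K _ _ n hcpt hn ℓ _ ι ρ hirr hgeo h1 hw => boundedWeak_of_pro (h K n hcpt hn ℓ ι ρ hirr hgeo h1 hw)

/-- RANK ⟺ W2S (EXACT: the residual of the lineage IS a rank-finiteness statement). -/
theorem rankBound_iff_weakToStrong : FernRankBound ↔ WeakToStrongFern :=
  ⟨weakToStrong_of_rankBound, rankBound_of_weakToStrong⟩

/-- Deciding theorem of the FERN-level child route with the re-typed residual: HF → RANK → FERN (both binders used). -/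
theorem closes_target (h₁ : HeckeFern) (h₂ : FernRankBound) : DepthPrimeSplit.FernSpread :=
  WeakFern.closes_target h₁ (weakToStrong_of_rankBound h₂)

/-- EXCH holds (the exchange, framed): the child route's glue item is PROVED here. -/
theorem sizeDepthExchange_holds : SizeDepthExchange :=
  fun K _ _ n hcpt hn ℓ _ ι ρ hirr hgeo hb => pro_of_boundedWeak hgeo.1 hb

/-- The child route's `closes` VERBATIM (glue.lean): HF → RANK → EXCH → FERN by pure logic (all three binders used; EXCH is proved above). -/
theorem closes_route (h₁ : HeckeFern) (h₂ : FernRankBound) (h₃ : SizeDepthExchange) : DepthPrimeSplit.FernSpread := by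
  intro K _ _ n hcpt hn ℓ _ ι ρ hirr hgeo h1
  exact h₃ K n hcpt hn ℓ ι ρ hirr hgeo (h₂ K n hcpt hn ℓ ι ρ hirr hgeo h1 (h₁ K n hcpt hn ℓ ι ρ hirr hgeo h1))

/-- RANK ⟸ FERN. -/
theorem rankBound_of_fernSpread (hF : DepthPrimeSplit.FernSpread) : FernRankBound :=
  rankBound_of_weakToStrong (weakToStrong_of_fernSpread hF)

/-- FERN ⟺ HF ∧ RANK (modulo nothing). -/
theorem fernSpread_iff_heckeFern_and_rankBound : DepthPrimeSplit.FernSpread ↔ HeckeFern ∧ FernRankBound :=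
  ⟨fun h => ⟨heckeFern_of_fernSpread h, rankBound_of_fernSpread h⟩, fun h => closes_target h.1 h.2⟩

/-- RANK ⟸ WCL. -/
theorem rankBound_of_weakClassicality (hW : WeakClassicality) : FernRankBound :=
  rankBound_of_weakToStrong (weakToStrong_of_weakClassicality hW)

/-- WCL ⟸ RANK ∧ CLASS: H1, C_w ⟹ (RANK + exchange) C ⟹ (CLASS) weakly automorphic. -/
theorem weakClassicality_of_rankBound_of_classicality (h₂ : FernRankBound) (hC : DepthPrimeSplit.Classicality) : WeakClassicality :=
  fun K _ _ n hcpt hn ℓ _ ι ρ hirr hgeo h1 hw => hC K n hcpt hn ℓ ι ρ hirr hgeo (weakToStrong_of_rankBound h₂ K n hcpt hn ℓ ι ρ hirr hgeo h1 hw)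

/-- WCL ⟺ RANK ∧ CLASS (modulo nothing): g29's bypass piece is NOT a new piece — it is the lineage residual (as RANK) AND DPS's CLASS. -/
theorem weakClassicality_iff_rankBound_and_classicality : WeakClassicality ↔ FernRankBound ∧ DepthPrimeSplit.Classicality :=
  ⟨fun h => ⟨rankBound_of_weakClassicality h, classicality_of_weakClassicality h⟩,
    fun h => weakClassicality_of_rankBound_of_classicality h.1 h.2⟩

/-- The DPS pair read in three pieces (modulo nothing): FERN ∧ CLASS ⟺ HF ∧ RANK ∧ CLASS. -/
theorem fernClass_iff_three : (DepthPrimeSplit.FernSpread ∧ DepthPrimeSplit.Classicality) ↔ (HeckeFern ∧ FernRankBound ∧ DepthPrimeSplit.Classicality) :=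
  ⟨fun h => ⟨heckeFern_of_fernSpread h.1, rankBound_of_fernSpread h.1, h.2⟩, fun h => ⟨closes_target h.1 h.2.1, h.2.2⟩⟩

/-- FREEZE · the READING of CLASS in the currency (NOT a new piece): bounded-size weak approximation to every depth ⟹ ONE frozen family
(`ρ` is an exact `𝒪`-point of ONE finite-rank cuspidal Hecke algebra). -/
def Freeze : Prop := Frame fun hcpt ι ρ => IsBoundedlyWeaklyProAutomorphic hcpt ι ρ → IsFrozenWeaklyProAutomorphic hcpt ι ρ

/-- CLASS ⟺ FREEZE (EXACT, modulo nothing: the frame's `IsPinnedGeometric` supplies the a.e.-unramifiedness both dictionary ends use). -/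
theorem classicality_iff_freeze : DepthPrimeSplit.Classicality ↔ Freeze :=
  ⟨fun h K _ _ n hcpt hn ℓ _ ι ρ hirr hgeo hb => frozen_of_weakly (h K n hcpt hn ℓ ι ρ hirr hgeo (pro_of_boundedWeak hgeo.1 hb)),
    fun h K _ _ n hcpt hn ℓ _ ι ρ hirr hgeo hc => weakly_of_frozen hgeo.1 (h K n hcpt hn ℓ ι ρ hirr hgeo (boundedWeak_of_pro hc))⟩

/-- The DPS pair in ONE currency (modulo nothing): FERN ∧ CLASS ⟺ HF ∧ RANK ∧ FREEZE — GROWTH · RANK · RIGIDITY of finite cuspidal families. -/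
theorem fernClass_iff_currency : (DepthPrimeSplit.FernSpread ∧ DepthPrimeSplit.Classicality) ↔ (HeckeFern ∧ FernRankBound ∧ Freeze) := by
  rw [fernClass_iff_three, classicality_iff_freeze]

/-! ## 15. Necessity (no EXCESS) and the root frame -/

/-- B_w (17414) ⟹ RANK. -/
theorem rankBound_of_weak (hB : PrimeSwitchSplit.WeakGeometricAutomorphy) : FernRankBound :=
  rankBound_of_weakToStrong (weakToStrong_of_weak hB)

/-- the summit ⟹ RANK (through g29's `pieces_of_langlands`). -/
theorem rankBound_of_langlands (hL : _root_.Langlands) : FernRankBound :=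
  rankBound_of_weakToStrong (WeakFern.pieces_of_langlands hL).2.1

/-- ROOT-IMPLIED certificate for the node's three pieces. -/
theorem pieces_of_langlands (hL : _root_.Langlands) : HeckeFern ∧ FernRankBound ∧ DepthPrimeSplit.Classicality :=
  ⟨(WeakFern.pieces_of_langlands hL).1, rankBound_of_langlands hL,
    classicality_of_weakClassicality (WeakFern.pieces_of_langlands hL).2.2.1⟩

/-- Root frame: `DepthPrimeSplit.closes` with FERN replaced by HF, RANK (nine binders → the summit; CLASS by name). -/
theorem closes_root (hD : DepthPrimeSplit.DyadicSeed) (hO : DepthPrimeSplit.OddPrimeSeed) (h₁ : HeckeFern) (h₂ : FernRankBound)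
    (hC : DepthPrimeSplit.Classicality) (hW : DepthPrimeSplit.SatakeAvatarExistence) (hP : DepthPrimeSplit.PadicMemberCompatibility)
    (hA : DepthPrimeSplit.CompatibilityAwayFromLR) (hR : DepthPrimeSplit.CanonicalReciprocityData) : _root_.Langlands :=
  DepthPrimeSplit.closes hD hO (closes_target h₁ h₂) hC hW hP hA hR

/-! ## 16. Separation / sharpness: the exponent `1/k` of the exchange is ATTAINED (𝒪 = ℤ, family {0, 2ℓ}, point ℓ) -/

/-- TOY WORLD (g29's `toy_weak_not_strong`, completed): the 2-member family {0, 2ℓ} weakly approximates the midpoint ℓ at depth 2, NO member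
is at depth 2, and ONE member is at depth 1 = 2 / (size 2) — the exchange bound `s = r^{1/k}` is sharp. -/
theorem toy_exchange_sharp {ℓ : ℤ} (h2 : 2 ≤ ℓ) :
    (∀ P : ℤ[X], P.eval 0 = 0 → P.eval (2 * ℓ) = 0 → ℓ ^ 2 ∣ P.eval ℓ) ∧ (¬ ℓ ^ 2 ∣ (ℓ - 0) ∧ ¬ ℓ ^ 2 ∣ (ℓ - 2 * ℓ)) ∧ ℓ ^ 1 ∣ (ℓ - 0) :=
  ⟨(toy_weak_not_strong h2).1, (toy_weak_not_strong h2).2, by simp⟩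
end Summit.Langlands.Langlands.Theorems.FernRank
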